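import Mathlib.Topology.MetricSpace.Isometry
import Mathlib.Topology.MetricSpace.HausdorffDistance
import Mathlib.Topology.MetricSpace.ProperSpace
import Mathlib.Analysis.Normed.Group.Ultra
import Mathlib.Analysis.Normed.Field.Basic
import Literature.NumberTheory.GaloisRepresentations.LocalFieldFiniteExtension   -- ★ R1 façade `IsNonarchimedeanLocalField.nontriviallyNormedField`, `norm_le_norm_iff_vle` (ED. 2, §4)
import HarnessLib

/-!
# A self-isometry of a compact metric space is surjective; ultrametric perturbations of the identity are isometries

Topic `Topology`; namespace `Literature.Topology`.  THEOREMS ONLY (no definition, no named fact, no `sorry`, no instance, no notation); Mathlib-only.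
Cell `hodgecm-mathlib`, ROAD «UP-TR» ∕ «JAC-LOC₂» (sub-dealer LH7-p02 (g8)), generic brick (S3): the surjectivity step of ORBIT-TUBE₂ «⊇» («a self-isometry of a compact
ultrametric space is onto»; the map `z ↦ Z(z)` there is a non-zero scalar times an isometry-perturbation of a closed ball).  Count-neutral.

* §1 `surjective_of_isometry_of_compactSpace` — an isometry `f : X → X` of a compact metric space is surjective (if `y ∉ f(X)`, a closed set at distance `ε > 0`, the orbit
  `fⁿ(y)` is `ε`-separated, contradicting sequential compactness); `bijective_…`.  (The tree had only a `private` copy, in ★ `PadicOneUnitsBinomialPowers`.)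
* §2 `norm_eq_of_norm_sub_lt`, `isometry_of_norm_sub_sub_lt` — in an ULTRAMETRIC normed group a map `g : S → S` with `‖(g z₁ − g z₂) − (z₁ − z₂)‖ < ‖z₁ − z₂‖` (`z₁ ≠ z₂`)
  is an isometry; hence (`S` compact) surjective: `surjective_of_norm_sub_sub_lt`.
* §3 `surjOn_closedBall_of_mul_perturbation` — in an ultrametric normed field with compact closed balls: `Z : K → K` mapping `B̄(0,r)` into `B̄(0,‖c‖r)` with
  `‖(Z z₁ − Z z₂) − c(z₁ − z₂)‖ < ‖c‖·‖z₁ − z₂‖` (`c ≠ 0`) maps `B̄(0,r)` ONTO `B̄(0,‖c‖r)` (and is injective there); `surjOn_closedBall_of_dist_eq_mul` — the exact-scaling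
  form `dist (f x) (f y) = ‖c‖·dist x y`, `f 0 = 0` (any normed field).
* §4 (ED. 2) `surjOn_of_isCompact_of_valuation_sub_eq` — VALUATION spelling on a non-archimedean local field `K`: `f` mapping a compact `S ⊆ K` into itself with
  `v(f x − f y) = v(x − y)` on `S` is onto `S` (R1 façade norm, monotone in the valuation, + §1).

## References
* [Schikhof1984] W. H. Schikhof, *Ultrametric Calculus*, Cambridge Stud. Adv. Math. 4 (1984), §27 (isometries and perturbations in non-archimedean analysis).
* [Folland1999] G. B. Folland, *Real Analysis*, 2nd ed. (1999), §0.6 ∕ §4.4 (sequential compactness in metric spaces) — folklore locator.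
-/

set_option autoImplicit false

open Set Function Filter Topology Metric

namespace Literature.Topology

/-! ## §1 Self-isometries of compact metric spaces -/

section Compact

variable {X : Type*} [MetricSpace X] [CompactSpace X]

/-- **A self-isometry of a compact metric space is surjective.** [cite: Schikhof1984, §27] [cite: Folland1999, §0.6] -/
theorem surjective_of_isometry_of_compactSpace {f : X → X} (hf : Isometry f) : Surjective f := by
  rcases isEmpty_or_nonempty X with hX | hX
  · exact fun y => (IsEmpty.false y).elim
  by_contra hsurj
  obtain ⟨y, hy⟩ : ∃ y, y ∉ range f := by simpa [Surjective, range] using hsurj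
  have hclosed : IsClosed (range f) := (isCompact_range hf.continuous).isClosed
  have hne : (range f).Nonempty := range_nonempty f
  have hε : 0 < infDist y (range f) := (hclosed.notMem_iff_infDist_pos hne).1 hy
  set ε := infDist y (range f) with hεdef
  have hiter : ∀ n (a b : X), dist (f^[n] a) (f^[n] b) = dist a b := by
    intro n
    induction n with
    | zero => intro a b; rfl
    | succ n ih => intro a b; rw [iterate_succ_apply', iterate_succ_apply', hf.dist_eq, ih]
  have hsep : ∀ m n, m < n → ε ≤ dist (f^[m] y) (f^[n] y) := by
    intro m n hmn
    obtain ⟨k, rfl⟩ := Nat.exists_eq_add_of_lt hmn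
    rw [show m + k + 1 = m + (k + 1) by ring, iterate_add_apply, hiter m]
    refine infDist_le_dist_of_mem ⟨f^[k] y, ?_⟩
    rw [iterate_succ_apply']
  obtain ⟨a, -, φ, hφ, hlim⟩ := (isCompact_univ (X := X)).tendsto_subseq (x := fun n => f^[n] y) (fun n => mem_univ _)
  rw [Metric.tendsto_atTop] at hlim
  obtain ⟨N, hN⟩ := hlim (ε / 2) (by positivity)
  have h1 := hN N le_rfl
  have h2 := hN (N + 1) (by omega)
  have h3 := hsep (φ N) (φ (N + 1)) (hφ (by omega))
  have h4 : dist (f^[φ N] y) (f^[φ (N + 1)] y) < ε := by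
    calc dist (f^[φ N] y) (f^[φ (N + 1)] y) ≤ dist (f^[φ N] y) a + dist (f^[φ (N + 1)] y) a := dist_triangle_right _ _ _
      _ < ε / 2 + ε / 2 := add_lt_add h1 h2
      _ = ε := by ring
  exact absurd h4 (not_lt.2 h3)

/-- A self-isometry of a compact metric space is bijective. [cite: Schikhof1984, §27] -/
theorem bijective_of_isometry_of_compactSpace {f : X → X} (hf : Isometry f) : Bijective f :=
  ⟨hf.injective, surjective_of_isometry_of_compactSpace hf⟩

end Compact

/-! ## §2 Ultrametric perturbations of the identity are isometries -/

section Ultra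

variable {E : Type*} [NormedAddCommGroup E] [IsUltrametricDist E]

/-- In an ultrametric normed group: `‖a − b‖ < ‖b‖ ⇒ ‖a‖ = ‖b‖` («the strongest wins»). [cite: Schikhof1984, §27] -/
theorem norm_eq_of_norm_sub_lt {a b : E} (h : ‖a - b‖ < ‖b‖) : ‖a‖ = ‖b‖ := by
  have hab : a = (a - b) + b := by abel
  rw [hab]
  exact IsUltrametricDist.norm_add_eq_max_of_norm_ne_norm h.ne ▸ max_eq_right h.le

/-- **An ultrametric perturbation of the identity is an isometry**: if `g : S → S` (any `S ⊆ E`) satisfies `‖(g z₁ − g z₂) − (z₁ − z₂)‖ < ‖z₁ − z₂‖` for `z₁ ≠ z₂`,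
then `g` is an isometry. [cite: Schikhof1984, §27] -/
theorem isometry_of_norm_sub_sub_lt {S : Set E} {g : S → S}
    (h : ∀ z₁ z₂ : S, z₁ ≠ z₂ → ‖((g z₁ : E) - g z₂) - ((z₁ : E) - z₂)‖ < ‖(z₁ : E) - z₂‖) : Isometry g := by
  refine Isometry.of_dist_eq fun z₁ z₂ => ?_
  rcases eq_or_ne z₁ z₂ with h0 | h0
  · subst h0; simp
  rw [Subtype.dist_eq, Subtype.dist_eq, dist_eq_norm, dist_eq_norm]
  exact norm_eq_of_norm_sub_lt (h z₁ z₂ h0)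

/-- **Hence surjective on a compact `S`** (§1). [cite: Schikhof1984, §27] -/
theorem surjective_of_norm_sub_sub_lt {S : Set E} [CompactSpace S] {g : S → S}
    (h : ∀ z₁ z₂ : S, z₁ ≠ z₂ → ‖((g z₁ : E) - g z₂) - ((z₁ : E) - z₂)‖ < ‖(z₁ : E) - z₂‖) : Surjective g :=
  surjective_of_isometry_of_compactSpace (isometry_of_norm_sub_sub_lt h)

end Ultra

/-! ## §3 The scaled closed ball in an ultrametric normed field -/

section Field

variable {K : Type*} [NormedField K] [IsUltrametricDist K]

/-- **A non-zero scalar times an isometry-perturbation maps `B̄(0,r)` ONTO `B̄(0,‖c‖·r)`.**  `Z : K → K` with `Z(B̄(0,r)) ⊆ B̄(0,‖c‖r)` and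
`‖(Z z₁ − Z z₂) − c·(z₁ − z₂)‖ < ‖c‖·‖z₁ − z₂‖` for `z₁ ≠ z₂` in `B̄(0,r)`, `c ≠ 0`, `B̄(0,r)` compact: then `Z` is injective on `B̄(0,r)` and `Z(B̄(0,r)) = B̄(0,‖c‖r)`
(apply §2 to `g := c⁻¹·Z` on the compact ball). [cite: Schikhof1984, §27] -/
theorem surjOn_closedBall_of_mul_perturbation {c : K} (hc : c ≠ 0) {r : ℝ} (hr : IsCompact (closedBall (0 : K) r)) (Z : K → K)
    (hZ : MapsTo Z (closedBall (0 : K) r) (closedBall (0 : K) (‖c‖ * r)))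
    (hpert : ∀ z₁ ∈ closedBall (0 : K) r, ∀ z₂ ∈ closedBall (0 : K) r, z₁ ≠ z₂ → ‖(Z z₁ - Z z₂) - c * (z₁ - z₂)‖ < ‖c‖ * ‖z₁ - z₂‖) :
    SurjOn Z (closedBall (0 : K) r) (closedBall (0 : K) (‖c‖ * r)) ∧ InjOn Z (closedBall (0 : K) r) := by
  have hc0 : 0 < ‖c‖ := norm_pos_iff.2 hc
  haveI : CompactSpace (closedBall (0 : K) r) := isCompact_iff_compactSpace.1 hr
  -- the normalised map `g := c⁻¹ • Z` on the ball
  have hg_mem : ∀ z : closedBall (0 : K) r, c⁻¹ * Z z ∈ closedBall (0 : K) r := by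
    intro z
    have hz := hZ z.2
    rw [mem_closedBall, dist_zero_right] at hz ⊢
    rw [norm_mul, norm_inv]
    calc ‖c‖⁻¹ * ‖Z z‖ ≤ ‖c‖⁻¹ * (‖c‖ * r) := by gcongr
      _ = r := by field_simp
  set g : closedBall (0 : K) r → closedBall (0 : K) r := fun z => ⟨c⁻¹ * Z z, hg_mem z⟩ with hgdef
  have hgpert : ∀ z₁ z₂ : closedBall (0 : K) r, z₁ ≠ z₂ →
      ‖((g z₁ : K) - g z₂) - ((z₁ : K) - z₂)‖ < ‖(z₁ : K) - z₂‖ := by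
    intro z₁ z₂ hne
    have hne' : (z₁ : K) ≠ z₂ := fun h => hne (Subtype.ext h)
    have hrew : ((g z₁ : K) - g z₂) - ((z₁ : K) - z₂) = c⁻¹ * ((Z z₁ - Z z₂) - c * ((z₁ : K) - z₂)) := by
      simp only [hgdef]
      field_simp
    rw [hrew, norm_mul, norm_inv]
    have h := hpert z₁ z₁.2 z₂ z₂.2 hne'
    calc ‖c‖⁻¹ * ‖(Z z₁ - Z z₂) - c * ((z₁ : K) - z₂)‖ < ‖c‖⁻¹ * (‖c‖ * ‖(z₁ : K) - z₂‖) := by gcongr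
      _ = ‖(z₁ : K) - z₂‖ := by field_simp
  have hgiso : Isometry g := isometry_of_norm_sub_sub_lt hgpert
  have hgsurj : Surjective g := surjective_of_isometry_of_compactSpace hgiso
  refine ⟨fun y hy => ?_, fun z₁ hz₁ z₂ hz₂ hZ12 => ?_⟩
  · -- surjectivity: `c⁻¹ y ∈ B̄(0,r)`
    have hy' : c⁻¹ * y ∈ closedBall (0 : K) r := by
      rw [mem_closedBall, dist_zero_right] at hy ⊢
      rw [norm_mul, norm_inv]
      calc ‖c‖⁻¹ * ‖y‖ ≤ ‖c‖⁻¹ * (‖c‖ * r) := by gcongr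
        _ = r := by field_simp
    obtain ⟨z, hz⟩ := hgsurj ⟨c⁻¹ * y, hy'⟩
    refine ⟨z, z.2, ?_⟩
    have h := congrArg (fun w : closedBall (0 : K) r => c * (w : K)) hz
    simpa [hgdef, mul_inv_cancel_left₀ hc] using h
  · -- injectivity
    have h := hgiso.injective (a₁ := ⟨z₁, hz₁⟩) (a₂ := ⟨z₂, hz₂⟩) (Subtype.ext (by simp [hgdef, hZ12]))
    exact congrArg Subtype.val h

/-- **Exact-scaling form**: `f : K → K` with `f 0 = 0` and `dist (f x) (f y) = ‖c‖ · dist x y` on `B̄(0,r)` (`c ≠ 0`, the ball compact) maps `B̄(0,r)` ONTO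
`B̄(0,‖c‖·r)` (the normalised `c⁻¹·f` is a self-isometry of the compact ball; §1).  No ultrametricity needed. [cite: Schikhof1984, §27] -/
theorem surjOn_closedBall_of_dist_eq_mul {K : Type*} [NormedField K] {c : K} (hc : c ≠ 0) {r : ℝ} (hr : IsCompact (closedBall (0 : K) r))
    (f : K → K) (hf0 : f 0 = 0)
    (hf : ∀ x ∈ closedBall (0 : K) r, ∀ y ∈ closedBall (0 : K) r, dist (f x) (f y) = ‖c‖ * dist x y) :
    SurjOn f (closedBall (0 : K) r) (closedBall (0 : K) (‖c‖ * r)) := by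
  have hc0 : 0 < ‖c‖ := norm_pos_iff.2 hc
  haveI : CompactSpace (closedBall (0 : K) r) := isCompact_iff_compactSpace.1 hr
  rcases lt_or_ge r 0 with hr0 | hr0
  · intro y hy
    rw [mem_closedBall, dist_zero_right] at hy
    exact absurd (hy.trans_lt (by nlinarith)) (not_lt.2 (norm_nonneg y))
  have h0mem : (0 : K) ∈ closedBall (0 : K) r := by rw [mem_closedBall, dist_self]; exact hr0
  have hnorm : ∀ x ∈ closedBall (0 : K) r, ‖f x‖ = ‖c‖ * ‖x‖ := by
    intro x hx
    have h := hf x hx 0 h0mem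
    rwa [hf0, dist_zero_right, dist_zero_right] at h
  have hg_mem : ∀ z : closedBall (0 : K) r, c⁻¹ * f z ∈ closedBall (0 : K) r := by
    intro z
    have hz := z.2
    rw [mem_closedBall, dist_zero_right] at hz ⊢
    rw [norm_mul, norm_inv, hnorm z z.2]
    calc ‖c‖⁻¹ * (‖c‖ * ‖(z : K)‖) = ‖(z : K)‖ := by field_simp
      _ ≤ r := hz
  set g : closedBall (0 : K) r → closedBall (0 : K) r := fun z => ⟨c⁻¹ * f z, hg_mem z⟩ with hgdef
  have hgiso : Isometry g := by
    refine Isometry.of_dist_eq fun z₁ z₂ => ?_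
    rw [Subtype.dist_eq, Subtype.dist_eq]
    simp only [hgdef]
    rw [dist_eq_norm, ← mul_sub, norm_mul, norm_inv, ← dist_eq_norm, hf z₁ z₁.2 z₂ z₂.2]
    field_simp
  have hgsurj : Surjective g := surjective_of_isometry_of_compactSpace hgiso
  intro y hy
  have hy' : c⁻¹ * y ∈ closedBall (0 : K) r := by
    rw [mem_closedBall, dist_zero_right] at hy ⊢
    rw [norm_mul, norm_inv]
    calc ‖c‖⁻¹ * ‖y‖ ≤ ‖c‖⁻¹ * (‖c‖ * r) := by gcongr
      _ = r := by field_simp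
  obtain ⟨z, hz⟩ := hgsurj ⟨c⁻¹ * y, hy'⟩
  refine ⟨z, z.2, ?_⟩
  have h := congrArg (fun w : closedBall (0 : K) r => c * (w : K)) hz
  simpa [hgdef, mul_inv_cancel_left₀ hc] using h

end Field

/-! ## §4 (ED. 2) The valuation spelling on a non-archimedean local field -/

section LocalField

open Literature.NumberTheory.GaloisRepresentations ValuativeRel

variable {K : Type*} [Field K] [ValuativeRel K] [TopologicalSpace K] [IsNonarchimedeanLocalField K]

/-- For the valuation norm (R1 façade): `v a = v b ⇒ ‖a‖ = ‖b‖`. [cite: Schikhof1984, §27] -/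
theorem norm_eq_norm_of_valuation_eq {a b : K} (h : valuation K a = valuation K b) :
    @Norm.norm K (IsNonarchimedeanLocalField.nontriviallyNormedField K).toNorm a =
      @Norm.norm K (IsNonarchimedeanLocalField.nontriviallyNormedField K).toNorm b := by
  refine le_antisymm ((IsNonarchimedeanLocalField.norm_le_norm_iff_vle K a b).2 ?_)
    ((IsNonarchimedeanLocalField.norm_le_norm_iff_vle K b a).2 ?_)
  · rw [Valuation.Compatible.vle_iff_le (v := valuation K)]; exact h.le
  · rw [Valuation.Compatible.vle_iff_le (v := valuation K)]; exact h.ge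

/-- **VALUATION SPELLING**: on a non-archimedean local field `K`, a map `f : K → K` sending a COMPACT `S` into itself with `v(f x − f y) = v(x − y)` for
`x, y ∈ S` maps `S` ONTO `S` (it is a self-isometry of the compact `S` for the valuation norm; §1).  The (B6) ORBIT-TUBE₂ «⊇» step reads it on the `γ`-ball of the
skew line `K⁻`. [cite: Schikhof1984, §27] -/
theorem surjOn_of_isCompact_of_valuation_sub_eq {S : Set K} (hS : IsCompact S) {f : K → K} (hf : MapsTo f S S)
    (h : ∀ x ∈ S, ∀ y ∈ S, valuation K (f x - f y) = valuation K (x - y)) : SurjOn f S S := by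
  letI : NontriviallyNormedField K := IsNonarchimedeanLocalField.nontriviallyNormedField K
  haveI : CompactSpace S := isCompact_iff_compactSpace.1 hS
  set g : S → S := fun z => ⟨f z, hf z.2⟩ with hgdef
  have hgiso : Isometry g := by
    refine Isometry.of_dist_eq fun z₁ z₂ => ?_
    rw [Subtype.dist_eq, Subtype.dist_eq, dist_eq_norm, dist_eq_norm]
    exact norm_eq_norm_of_valuation_eq (h z₁ z₁.2 z₂ z₂.2)
  intro y hy
  obtain ⟨z, hz⟩ := surjective_of_isometry_of_compactSpace hgiso ⟨y, hy⟩
  exact ⟨z, z.2, congrArg Subtype.val hz⟩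

omit [TopologicalSpace K] [IsNonarchimedeanLocalField K] in
/-- The same with injectivity on `S`. [cite: Schikhof1984, §27] -/
theorem injOn_of_valuation_sub_eq {S : Set K} {f : K → K}
    (h : ∀ x ∈ S, ∀ y ∈ S, valuation K (f x - f y) = valuation K (x - y)) : InjOn f S := by
  intro x hx y hy hxy
  have hv := h x hx y hy
  rw [hxy, sub_self, Valuation.map_zero] at hv
  exact sub_eq_zero.1 ((Valuation.zero_iff _).1 hv.symm)

end LocalField

end Literature.Topology
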